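import Literature.MathematicalPhysics.QuantumLattice.HubbardWindowCertificate
import Literature.MathematicalPhysics.QuantumLattice.BdGBondHamiltonian
import Literature.MathematicalPhysics.QuantumLattice.MagneticHubbardTorusGauge
import HarnessLib

/-!
# Flux-torus ceiling I — the gauge automorphism `Ad(W_g)` of the CAR algebra

HONEST FRAMING: first certified bounds; not a superconductivity verdict; every number certified or
labelled float. Part 1 of the kernel transport of window certificates to the flux sectors of the
Hubbard torus (`Rows/TorusCeilingFlux.lean`): the inner `*`-automorphism `Ad(W_g) : a ↦ W_g a W_gᴴ`
implemented by the gauge unitary `W_g = phaseGauge g` (`BdGBondHamiltonian.lean`), its action on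
letters, ladder words (unimodular phases `wordGauge`), Gram forms, and its NATURALITY with respect to
second-quantised embeddings `Γ(φ)`. [cite: Lieb1994, eq. (1)] [cite: BratteliRobinsonII1997, §5.2.2]
-/

noncomputable section

open Matrix Finset
open Literature.MathematicalPhysics.QuantumLattice
open Literature.MathematicalPhysics.QuantumFieldTheory hiding Site
open Literature.MathematicalPhysics.QuantumManyBody.StateRelaxation
open Literature.Probability.LatticeModels
open HubbardWave0
open scoped ComplexOrder ComplexConjugate

namespace Summit.Ventures.CertifiedManyBodySolver.Rows

/-! ### §1. The gauge automorphism `Ad(W_g)` and its naturality -/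

section GaugeAut

variable {Λ Λ' : Type*} [LinearOrder Λ] [Fintype Λ] [LinearOrder Λ'] [Fintype Λ']

/-- `Ad(W_g) : a ↦ W_g a W_gᴴ`, the inner `*`-automorphism of the CAR algebra implemented by the
site-phase unitary `phaseGauge g`. [folklore; Koma–Tasaki PRL 68 (1992) eq. (5)] -/
def gaugeAut (g : Λ → Circle) :
    Matrix (Finset (Orb Λ)) (Finset (Orb Λ)) ℂ →ₐ[ℂ] Matrix (Finset (Orb Λ)) (Finset (Orb Λ)) ℂ where
  toFun b := phaseGauge g * b * (phaseGauge g)ᴴ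
  map_one' := by rw [Matrix.mul_one, phaseGauge_mul_conjTranspose_self]
  map_mul' b c := phaseGauge_mul_mul_mul_conjTranspose g b c
  map_zero' := by rw [Matrix.mul_zero, Matrix.zero_mul]
  map_add' b c := by rw [Matrix.mul_add, Matrix.add_mul]
  commutes' c := by
    rw [Algebra.algebraMap_eq_smul_one, Matrix.mul_smul, Matrix.mul_one, Matrix.smul_mul,
      phaseGauge_mul_conjTranspose_self]

/-- `Ad(W_g) b = W_g b W_gᴴ` (definitional). [folklore] -/
theorem gaugeAut_apply (g : Λ → Circle) (b : Matrix (Finset (Orb Λ)) (Finset (Orb Λ)) ℂ) :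
    gaugeAut g b = phaseGauge g * b * (phaseGauge g)ᴴ := rfl

/-- `Ad(W_g) a_i = conj g(i) • a_i`. [folklore] -/
theorem gaugeAut_annihilation (g : Λ → Circle) (i : Orb Λ) :
    gaugeAut g (annihilation i) = conj (g (ofLex i).1 : ℂ) • annihilation i :=
  phaseGauge_mul_annihilation_mul_conjTranspose g (ofLex i).1 (ofLex i).2

/-- `Ad(W_g) a†_i = g(i) • a†_i`. [folklore] -/
theorem gaugeAut_creation (g : Λ → Circle) (i : Orb Λ) :
    gaugeAut g (creation i) = (g (ofLex i).1 : ℂ) • creation i :=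
  phaseGauge_mul_creation_mul_conjTranspose g (ofLex i).1 (ofLex i).2

/-- `Ad(W_g)` is a `*`-map. [folklore] -/
theorem gaugeAut_conjTranspose (g : Λ → Circle) (b : Matrix (Finset (Orb Λ)) (Finset (Orb Λ)) ℂ) :
    gaugeAut g bᴴ = (gaugeAut g b)ᴴ :=
  phaseGauge_mul_conjTranspose_mul_conjTranspose g b

/-- Number operators are gauge invariant. [folklore] -/
theorem gaugeAut_numberOp (g : Λ → Circle) (x : Λ) (σ : Fin 2) :
    gaugeAut g (numberOp x σ) = numberOp x σ :=
  phaseGauge_mul_numberOp_mul_conjTranspose g x σ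

/-- **Naturality**: `Ad(W_g) ∘ Γ(φ) = Γ(φ) ∘ Ad(W_{g ∘ φ})` (both are unital algebra maps agreeing on
the CAR generators). [folklore] -/
theorem gaugeAut_fermionEmbed (g : Λ' → Circle) (φ : Λ ↪ Λ')
    (Z : Matrix (Finset (Orb Λ)) (Finset (Orb Λ)) ℂ) :
    gaugeAut g (fermionEmbed φ Z) = fermionEmbed φ (gaugeAut (g ∘ φ) Z) := by
  have key : (gaugeAut g).comp (fermionEmbed φ) = (fermionEmbed φ).comp (gaugeAut (g ∘ φ)) := by
    refine algHom_ext_car (fun i => ?_) (fun i => ?_)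
    · rw [AlgHom.comp_apply, AlgHom.comp_apply, fermionEmbed_annihilation', gaugeAut_annihilation,
        gaugeAut_annihilation, map_smul, fermionEmbed_annihilation']
      rfl
    · rw [AlgHom.comp_apply, AlgHom.comp_apply, fermionEmbed_creation', gaugeAut_creation,
        gaugeAut_creation, map_smul, fermionEmbed_creation']
      rfl
  exact congrArg (fun f : _ →ₐ[ℂ] _ => f Z) key

/-- The phase a ladder word picks up under `Ad(W_g)`. -/
def wordGauge (g : Λ → Circle) (l : List (Orb Λ × Bool)) : Circle :=
  (l.map fun p => if p.2 then g (ofLex p.1).1 else (g (ofLex p.1).1)⁻¹).prod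

omit [LinearOrder Λ] [Fintype Λ] in
/-- The empty word picks up no phase. [folklore] -/
@[simp] theorem wordGauge_nil (g : Λ → Circle) : wordGauge g [] = 1 := by simp [wordGauge]

omit [LinearOrder Λ] [Fintype Λ] in
/-- The word phase, letter by letter. [folklore] -/
theorem wordGauge_cons (g : Λ → Circle) (p : Orb Λ × Bool) (l : List (Orb Λ × Bool)) :
    wordGauge g (p :: l) = (if p.2 then g (ofLex p.1).1 else (g (ofLex p.1).1)⁻¹) * wordGauge g l := by
  simp [wordGauge]

/-- `Ad(W_g)` of a single ladder letter. [folklore] -/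
theorem gaugeAut_ladderLetter (g : Λ → Circle) (p : Orb Λ × Bool) :
    gaugeAut g (ladderLetter p) =
      ((if p.2 then g (ofLex p.1).1 else (g (ofLex p.1).1)⁻¹ : Circle) : ℂ) • ladderLetter p := by
  rcases p with ⟨i, b⟩
  cases b
  · simp only [ladderLetter, if_false, Bool.false_eq_true]
    rw [gaugeAut_annihilation, Circle.coe_inv_eq_conj]
  · simp only [ladderLetter, if_true]
    rw [gaugeAut_creation]

/-- `Ad(W_g)(a₁⋯aₖ) = (∏ phases) • a₁⋯aₖ`. [folklore] -/
theorem gaugeAut_ladderWord (g : Λ → Circle) (l : List (Orb Λ × Bool)) :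
    gaugeAut g (ladderWord l) = (wordGauge g l : ℂ) • ladderWord l := by
  induction l with
  | nil => simp
  | cons p l ih =>
    rw [ladderWord_cons, map_mul, ih, gaugeAut_ladderLetter, smul_mul_smul, wordGauge_cons,
      Circle.coe_mul]

omit [LinearOrder Λ] [Fintype Λ] in
/-- Word phases are unimodular. [folklore] -/
theorem norm_wordGauge (g : Λ → Circle) (l : List (Orb Λ × Bool)) : ‖(wordGauge g l : ℂ)‖ = 1 :=
  Circle.norm_coe _

/-- `Ad(W_g)` of a Gram form is the Gram form of the conjugated observables. [folklore] -/
theorem gaugeAut_gramForm (g : Λ → Circle) {m : Type*} [Fintype m] (Λm : Matrix m m ℂ)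
    (O : m → Matrix (Finset (Orb Λ)) (Finset (Orb Λ)) ℂ) :
    gaugeAut g (gramForm Λm O) = gramForm Λm (fun i => gaugeAut g (O i)) := by
  simp only [gramForm, map_sum, map_smul, map_mul, star_eq_conjTranspose, gaugeAut_conjTranspose]

end GaugeAut

section GaugeAutExtra

/-- `Ad(W_{fg}) = Ad(W_f) ∘ Ad(W_g)`. -/
theorem gaugeAut_mul_apply {Λ : Type*} [LinearOrder Λ] [Fintype Λ] (f g : Λ → Circle)
    (b : Matrix (Finset (Orb Λ)) (Finset (Orb Λ)) ℂ) :
    gaugeAut (f * g) b = gaugeAut f (gaugeAut g b) := by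
  rw [gaugeAut_apply, gaugeAut_apply, gaugeAut_apply, ← phaseGauge_mul, conjTranspose_mul]
  simp only [Matrix.mul_assoc]

/-- `Ad(W_g) a†_{xσ} = g(x) • a†_{xσ}`. [folklore] -/
theorem gaugeAut_creation_orb {Λ : Type*} [LinearOrder Λ] [Fintype Λ] (g : Λ → Circle) (x : Λ) (σ : Fin 2) :
    gaugeAut g (creation (orb x σ)) = (g x : ℂ) • creation (orb x σ) :=
  gaugeAut_creation g (orb x σ)

/-- `Ad(W_g) a_{xσ} = conj g(x) • a_{xσ}`. [folklore] -/
theorem gaugeAut_annihilation_orb {Λ : Type*} [LinearOrder Λ] [Fintype Λ] (g : Λ → Circle) (x : Λ)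
    (σ : Fin 2) : gaugeAut g (annihilation (orb x σ)) = conj (g x : ℂ) • annihilation (orb x σ) :=
  gaugeAut_annihilation g (orb x σ)

end GaugeAutExtra

end Summit.Ventures.CertifiedManyBodySolver.Rows
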